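/-
Origin: expansion seat `planner-pub-hodgecm-pv02-g6-0`, handover #2 v2 2026-08-18T10:07:35Z doc-only (`HOME/pub-hodgecm-pv02-g6/lean/Pv02g6/ArchAWeilGenuine.lean`, md5 c3e1807f, 206 lines);
landed by the gen-7 packager in gate run 28 REPLACES the earlier landed copy of `HodgeCM/PerL34/ArchAWeilGenuine.lean` (import ^import Pv[0-9]+g[0-9]+\.→import HodgeCM.PerL34. ×2).
-/
/-
Origin: HOME/pub-hodgecm-pv02-g6/lean/Pv02g6/ArchAWeilGenuine.lean (module `Pv02g6.ArchAWeilGenuine`; the packager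
renames to `HodgeCM.PerL34.ArchAWeilGenuine` and rewrites `import Pv02g6.ArchAWeilKFinite` ↦
`import HodgeCM.PerL34.ArchAWeilKFinite`, `import Pv11g5.RealPlaceCircles` ↦ `import HodgeCM.PerL34.RealPlaceCircles`)
— session planner-pub-hodgecm-pv02-g6-0 (unit pub-hodgecm-pv02-g6, DAG-NODE PROVER #02 gen 6).
DAG node (HOME/LEMMAS.md v14 §1): N27 = PerL v5 Lemma 4.1(a) `lem:arch` (tex ll. 480–482, pf 493–496; set-up
ll. 262–266, 470–478) over PerL's GENUINE torus `U(W_i)(𝔸) = U(1)_{L/L⁺}(𝔸_{L⁺})`, and the junction of its local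
condition `χ'_{i,b}(u) = u^{e_b}` with the archimedean TYPES of Lemma 4.2(a) (N30; pv11-g5).
Imports: this seat's `ArchAWeilKFinite` (#1) + pv11-g5 `RealPlaceCircles` (HANDOVER #5 1ac4647756f7, run 27).
v2 (DOC-ONLY, adv2g22-C57): `N27_genuine`'s docstring cites ll. 265–268 as the warrant for the `K`-finite reading;
Lean code byte-identical to v1 decf27f9bf57.
-/
import Summits.HodgeConjecture.HodgeCM.PerL34.ArchAWeilKFinite
import Summits.HodgeConjecture.HodgeCM.PerL34.RealPlaceCircles

/-!
# N27 (PerL v5 Lemma 4.1(a)) over the genuine torus `U(W_i)(𝔸) = relNormOneIdeles L⁺ L`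

PerL v5 l. 476 (verbatim): "$\U(W_{i,b})=\U(1)$ acts on it by a character $u\mapsto u^{-e_b(\Psi_i)}$, which
\emph{defines} $e_b(\Psi_i)\in\Z$"; Lemma 4.1(a), ll. 480–482: "If $\theta(\phi,\chi'_i)\ne0$ has archimedean
components in $J^+\otimes\mathbf 1^{\otimes}$ then $\chi'_{i,b}(u)=u^{e_b(\Psi_i)}$ for all $b$; conversely for such
$\chi'_i$ the archimedean theta lifts are $J^+$ at $\iota_1$ and $\mathbf 1$ elsewhere."

The landed rendering (`HodgeCM.PerL34.ArchA.LineArchData.N27_statement`, pv02 run 19) and its proof over a Weil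
theta model (`ArchAWeil` run 26, `ArchAWeilFinite` run 27, `ArchAWeilKFinite` = this seat's #1) keep the torus side
as DATA: a commutative `G = U(W_i)(𝔸)` with cocompact `Γ = U(W_i)(L₀)` and real-place circles
`ι : RealPl → (Circle →* G)`, subject to ONE set-up hypothesis, `∀ b, Continuous (ι b)`.

THIS FILE instantiates that data with PerL's genuine objects, all LANDED or queued by the torus seats and consumed
BY NAME (nothing of the torus side is constructed here):

* `G := relNormOneIdeles L⁺ L` = `U(1)_{L/L⁺}(𝔸_{L⁺})` (pv11-g4 `NormOneRelTorus`, run 2x: commutative topological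
  group; `[U(W_i)] = G ⧸ relNormOneRat L⁺ L` COMPACT, Hausdorff, Borel — instances `compactSpace_relNormOneQuot`,
  `measurableSpace_relNormOneQuot`, `borelSpace_relNormOneQuot`);
* `RealPl := InfinitePlace L⁺` (the real places `b` of `L₀ = L⁺`), `ι := NumberField.realPlaceCircle L` (pv11-g5
  `RealPlaceCircles`, run 27: the circle `U(W_{i,b}) → U(W_i)(𝔸)`, `w_b`-component `u`, all others `1`), whose
  continuity `NumberField.continuous_realPlaceCircle` DISCHARGES the set-up hypothesis;
* the characters `χ'` = `PontryaginDual [U(W_i)]` = the `X` of `lineData` (`ContinuousMonoidHom _ Circle`).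

Results (every `M : WeilThetaModel GU ΓU (relNormOneIdeles L⁺ L) (relNormOneRat L⁺ L)`, any `G_U`-side `GU`, `ΓU`
with `[G_U]` compact — e.g. PerL's `U(V)(𝔸)` by the kernel Godement criterion of pv10-g3, run 27/28):

* `lineData_loc_realPlaceCircle` — the local component `χ'_{i,b} = χ' ∘ toQ b` of the datum IS
  `χ' ∘ realPlaceCircleQuot L b` (`rfl`);
* **`locMatches_iff_hasArchType`** — `(lineData M ι₁ (realPlaceCircle L) kJ).LocMatches χ' ↔
  HasArchType L χ' ((fun b => - kJ b) ∘ IsCMField.equivInfinitePlace L)`: N27's condition "`χ'_{i,b}(u) = u^{e_b}`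
  for all `b`" (with PerL's `e_b = -kJ b`, `ArchA.LineArchData.e`) IS "`χ'` has archimedean type `e`" of Lemma 4.2(a)
  (pv11-g5 `SeesawTorus.forall_realPlaceCircle_iff_hasArchType`, by name);
* **`exists_char_locMatches`** — for every weight datum `kJ` there IS an automorphic character `χ'` of `[U(W_i)]`
  with `LocMatches χ'` (PerL Lemma 4.2(a) = pv11-g5 node 3 `exists_char_forall_realPlaceCircle`): the converse
  half of N27 is never vacuous on the genuine torus; **`kJ_eq_of_locMatches`** — the weights are determined by `χ'`;
* **`N27_genuine_finite (hfin : OrbitFinite M (realPlaceCircle L))`** and, with #1's `K`-finite sub-model,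
  **`N27_genuine : (lineData (M.kFinite (realPlaceCircle L)) ι₁ (realPlaceCircle L) kJ).N27_statement`** —
  PerL v5 Lemma 4.1(a) over the genuine torus with binder list = THE MODEL `M` ONLY (`ι₁`, `kJ` are the names of
  the distinguished place and of the [BW] weights);
* **`N27_genuine_types`** — the same statement with `LocMatches` replaced by `HasArchType` (the form in which N30 /
  N31a consume it: "real places by choice of e(Ψ_i) (L4.1(a))", LEMMAS N31a).

RESIDUAL of the N27 row after this file: an INSTANCE `M` of prl1-g4's `WeilThetaModel` for PerL's dual pair
`U(V) × U(W_i)` over `relNormOneIdeles L⁺ L` (the adelic theta MODEL, GAPS carverg2-X1) — nothing else: no PRINT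
input, no finiteness hypothesis, no set-up hypothesis on the torus side.

VACUITY NOTE.  The conclusions quantify over ALL continuous unitary characters of the genuine compact quotient
`[U(W_i)]`, a type inhabited by characters of EVERY archimedean type (`exists_char_locMatches`); the index space of
`M.kFinite _` is discussed in #1.  No statement of N27 / PerL / QW8 / the 2001 programme is a hypothesis; nothing is
cited; nothing is posited.
-/

set_option autoImplicit false

noncomputable section

open Topology

namespace HodgeCM
namespace PerL34
namespace ArchAWeil

open ArchA NumberField NumberField.SeesawTorus

variable {GU : Type} [Group GU] [TopologicalSpace GU] [IsTopologicalGroup GU] {ΓU : Subgroup GU}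
  [CompactSpace (GU ⧸ ΓU)]
variable (L : Type) [Field L] [NumberField L] [IsCMField L]

local notation "L⁺" => maximalRealSubfield L

-- (`variable` binders spell `maximalRealSubfield L` out: a `local notation` capturing the section variable `L`
-- does not re-elaborate inside `variable` binder types.)
variable (M : WeilThetaModel GU ΓU (relNormOneIdeles (maximalRealSubfield L) L) (relNormOneRat (maximalRealSubfield L) L))
  (ι₁ : InfinitePlace (maximalRealSubfield L)) (kJ : InfinitePlace (maximalRealSubfield L) → ℤ)

/-! ## §1  The dictionary: `toQ b = realPlaceCircleQuot L b`, `loc χ' b = χ' ∘ realPlaceCircleQuot L b` -/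

/-- The image of `U(W_{i,b})` in `[U(W_i)]` of the genuine line datum is pv11-g5's `realPlaceCircleQuot L b`. -/
theorem lineData_toQ_realPlaceCircle (b : InfinitePlace L⁺) (u : Circle) :
    (lineData M ι₁ (realPlaceCircle L) kJ).toQ b u = realPlaceCircleQuot L b u := rfl

/-- The local component `χ'_{i,b}(u)` of the genuine line datum. -/
theorem lineData_loc_realPlaceCircle (χ : PontryaginDual (relNormOneIdeles L⁺ L ⧸ relNormOneRat L⁺ L))
    (b : InfinitePlace L⁺) (u : Circle) :
    (lineData M ι₁ (realPlaceCircle L) kJ).loc χ b u = χ (realPlaceCircleQuot L b u) := rfl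

/-- PerL's exponent `e_b = -kJ b` (`ArchA.LineArchData.e`, tex l. 476) for the genuine datum. -/
theorem lineData_e_realPlaceCircle (b : InfinitePlace L⁺) :
    (lineData M ι₁ (realPlaceCircle L) kJ).e b = - kJ b := rfl

/-- `LocMatches χ'` of the genuine datum, unfolded: `χ'(cl(ι_b u)) = u ^ (-kJ b)` in `ℂ` for all `b`, `u`. -/
theorem locMatches_iff_forall (χ : PontryaginDual (relNormOneIdeles L⁺ L ⧸ relNormOneRat L⁺ L)) :
    (lineData M ι₁ (realPlaceCircle L) kJ).LocMatches χ ↔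
      ∀ (b : InfinitePlace L⁺) (u : Circle),
        ((χ (realPlaceCircleQuot L b u) : Circle) : ℂ) = (u : ℂ) ^ (- kJ b) :=
  Iff.rfl

/-! ## §2  `LocMatches` IS the archimedean type of Lemma 4.2(a) -/

/-- **N27's local condition is N30's archimedean type**: `χ'_{i,b}(u) = u^{e_b}` at every real place `b` iff `χ'`
has archimedean type `e ∘ (w ↦ w|_{L⁺})`, `e_b = -kJ b` (pv11-g5 `forall_realPlaceCircle_iff_hasArchType`). -/
theorem locMatches_iff_hasArchType (χ : PontryaginDual (relNormOneIdeles L⁺ L ⧸ relNormOneRat L⁺ L)) :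
    (lineData M ι₁ (realPlaceCircle L) kJ).LocMatches χ ↔
      HasArchType L χ ((fun b => - kJ b) ∘ IsCMField.equivInfinitePlace L) :=
  (locMatches_iff_forall L M ι₁ kJ χ).trans (forall_realPlaceCircle_iff_hasArchType χ fun b => - kJ b)

/-- The same with the type indexed by the places `w` of `L`: `m w = -kJ (w|_{L⁺})`. -/
theorem locMatches_iff_hasArchType' (χ : PontryaginDual (relNormOneIdeles L⁺ L ⧸ relNormOneRat L⁺ L)) :
    (lineData M ι₁ (realPlaceCircle L) kJ).LocMatches χ ↔
      HasArchType L χ fun w => - kJ (IsCMField.equivInfinitePlace L w) :=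
  locMatches_iff_hasArchType L M ι₁ kJ χ

/-- **Supply (PerL Lemma 4.2(a))**: for every weight datum `kJ` some automorphic character `χ'` of `[U(W_i)]` has
the local components `χ'_{i,b}(u) = u^{e_b}` demanded by N27 (pv11-g5 node 3, by name). -/
theorem exists_char_locMatches :
    ∃ χ : PontryaginDual (relNormOneIdeles L⁺ L ⧸ relNormOneRat L⁺ L),
      (lineData M ι₁ (realPlaceCircle L) kJ).LocMatches χ :=
  exists_char_forall_realPlaceCircle fun b => - kJ b

/-- **The weights are determined by the character** (pv11-g5 node 4 `HasArchType.unique`): if `χ'` matches the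
local conditions of the data with weights `kJ` and `kJ'` then `kJ = kJ'`. -/
theorem kJ_eq_of_locMatches {kJ kJ' : InfinitePlace L⁺ → ℤ}
    (χ : PontryaginDual (relNormOneIdeles L⁺ L ⧸ relNormOneRat L⁺ L))
    (h : (lineData M ι₁ (realPlaceCircle L) kJ).LocMatches χ)
    (h' : (lineData M ι₁ (realPlaceCircle L) kJ').LocMatches χ) : kJ = kJ' := by
  have he := (locMatches_iff_hasArchType L M ι₁ kJ χ).mp h
  have he' := (locMatches_iff_hasArchType L M ι₁ kJ' χ).mp h'
  have heq := HasArchType.unique he he'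
  funext b
  have hb := congrFun heq ((IsCMField.equivInfinitePlace L).symm b)
  simp only [Function.comp_apply, Equiv.apply_symm_apply, neg_inj] at hb
  exact hb

/-! ## §3  N27 over the genuine torus -/

/-- **N27 over the genuine torus, modulo `K`-finiteness of the given index space** (pv02-g5's net form with the
set-up hypothesis DISCHARGED by `continuous_realPlaceCircle`). -/
theorem N27_genuine_finite (hfin : OrbitFinite M (realPlaceCircle L)) :
    (lineData M ι₁ (realPlaceCircle L) kJ).N27_statement :=
  N27_ofWeilModel_finite M (realPlaceCircle L) ι₁ kJ (continuous_realPlaceCircle L) hfin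

/-- **N27 = PerL v5 Lemma 4.1(a) over the genuine torus `U(W_i)(𝔸) = U(1)_{L/L⁺}(𝔸_{L⁺})`, binder list = the
Weil theta MODEL `M` only**: for the `K`-finite index space of any `M` (the vectors whose lifts span print's theta
space, ll. 265–268; Fock = `K`-finite, l. 264), pv02's verbatim rendering `N27_statement` holds for the line datum with
the genuine real-place circles. -/
theorem N27_genuine :
    (lineData (M.kFinite (realPlaceCircle L)) ι₁ (realPlaceCircle L) kJ).N27_statement :=
  N27_kFinite M (realPlaceCircle L) ι₁ kJ (continuous_realPlaceCircle L)

/-- **N27 over the genuine torus in the language of archimedean TYPES** (the form consumed downstream, LEMMAS N31a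
"real places by choice of e(Ψ_i) (L4.1(a))"): for every automorphic character `χ'` of `[U(W_i)]`,
(⇒) if some `θ(φ, χ') ≠ 0` and the lift has archimedean components in `J⁺ ⊗ 𝟏^{⊗}` then `χ'` has archimedean type
`b ↦ e_b = -kJ b`; (⇐) if `χ'` has that type then only the `J⁺` / `𝟏` weight spaces contribute to the lifts. -/
theorem N27_genuine_types (χ : PontryaginDual (relNormOneIdeles L⁺ L ⧸ relNormOneRat L⁺ L)) :
    ((∃ φ, (lineData (M.kFinite (realPlaceCircle L)) ι₁ (realPlaceCircle L) kJ).lift χ φ ≠ 0) →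
        (lineData (M.kFinite (realPlaceCircle L)) ι₁ (realPlaceCircle L) kJ).HasArchJ χ →
          HasArchType L χ ((fun b => - kJ b) ∘ IsCMField.equivInfinitePlace L)) ∧
      (HasArchType L χ ((fun b => - kJ b) ∘ IsCMField.equivInfinitePlace L) →
        (lineData (M.kFinite (realPlaceCircle L)) ι₁ (realPlaceCircle L) kJ).HasArchJ χ) := by
  have h27 := N27_genuine L M ι₁ kJ χ
  rw [locMatches_iff_hasArchType L (M.kFinite (realPlaceCircle L)) ι₁ kJ χ] at h27
  exact h27

/-- The same over a given `K`-finite index space (`OrbitFinite` as hypothesis, no sub-model). -/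
theorem N27_genuine_types_finite (hfin : OrbitFinite M (realPlaceCircle L))
    (χ : PontryaginDual (relNormOneIdeles L⁺ L ⧸ relNormOneRat L⁺ L)) :
    ((∃ φ, (lineData M ι₁ (realPlaceCircle L) kJ).lift χ φ ≠ 0) →
        (lineData M ι₁ (realPlaceCircle L) kJ).HasArchJ χ →
          HasArchType L χ ((fun b => - kJ b) ∘ IsCMField.equivInfinitePlace L)) ∧
      (HasArchType L χ ((fun b => - kJ b) ∘ IsCMField.equivInfinitePlace L) →
        (lineData M ι₁ (realPlaceCircle L) kJ).HasArchJ χ) := by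
  have h27 := N27_genuine_finite L M ι₁ kJ hfin χ
  rw [locMatches_iff_hasArchType L M ι₁ kJ χ] at h27
  exact h27

/-- **Non-vacuity of the converse half on the genuine torus**: there IS a character to which (⇐) applies, and for
it only the `J⁺`/`𝟏` weight spaces contribute to the theta lifts. -/
theorem exists_char_hasArchJ :
    ∃ χ : PontryaginDual (relNormOneIdeles L⁺ L ⧸ relNormOneRat L⁺ L),
      HasArchType L χ ((fun b => - kJ b) ∘ IsCMField.equivInfinitePlace L) ∧
        (lineData (M.kFinite (realPlaceCircle L)) ι₁ (realPlaceCircle L) kJ).HasArchJ χ := by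
  obtain ⟨χ, hχ⟩ := exists_char_locMatches L (M.kFinite (realPlaceCircle L)) ι₁ kJ
  have hT := (locMatches_iff_hasArchType L (M.kFinite (realPlaceCircle L)) ι₁ kJ χ).mp hχ
  exact ⟨χ, hT, (N27_genuine_types L M ι₁ kJ χ).2 hT⟩

end ArchAWeil
end PerL34
end HodgeCM

end
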